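import Summits.CriticalPhenomena.PercolationContinuityZ3.Theorems.Transplant.SkelNegBParamsSched
import HarnessLib

/-!
# N1 params, chain of record `NegB`, part Col: THE COLUMN VERTEX OF RECORD `NegB.colV … y` over each planar cell centre — the (C) binders `cOf/hcF/hcQ/hcD` of p5's
# `reachOblRHN_negSG₂` (p288174, list 2026-08-21T16:10:49Z): `F (colV y) = cen y`, `colV y ∈ VWin F t (Q y) (rQ a y)` for every level `a` of the schedule of record, and
# `colV y ∈ graphBall t (cOff·‖y‖₁ + 1)` (`cC := cOff = 800(ℓ_L + 21n_L + 1)`, `dC := 1`)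

builds on p205010 (kernel theorem, internal audit signed; external expert review pending) — nothing in this file uses p205010; NOTHING is claimed about
the node `SamePDropOfSkeletonNeg₁` (OPEN).
Status sentence (coordinator 2026-08-20T04:30Z): "θ(p_c) = 0 on ℤ^d, all d ≥ 2 — kernel-verified (Lean 4/Mathlib, standard axioms); internal adversarial
audit SIGNED 2026-08-20 04:29Z; external expert review pending."
Lane `prim-bschramm-*`, seat `prim-bschramm-stmt` (gen 13); helper file (`--supports stmt-CriticalPhenomena-4575 --as helper`); ledger HOME/prim-bschramm-stmt/NEG-PARAMS.md v0.10.
THE CHOICE: `colV y` := the vertex of `hcol_fine_at` at the least radius `Nrep (cen y) + 1` (hp-8's column device `hcol_fineSkel`: a vertex of the window span `VWin F t (Q y) (Nrep (cen y) + 1)`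
with `F = cen y`); window spans are monotone in the radius (`VWin_mono`), so the same vertex serves every schedule level `a` (`Nrep (cen y) + 1 ≤ rQ a y` = `colQ_schedOf`), and lies in
the graph ball of radius `offN y ≤ cOff·‖y‖₁ + 1` (`offN_le`).
* `colV` (+ `colV_spec`), **`colV_eq`** (`hcF`), **`colV_mem_VWin`** (`hcQ`, any radius `≥ Nrep (cen y) + 1`), **`colV_mem_VWin_schedOf`** (at `schedOf S`), **`colV_mem_graphBall`** (`hcD`).
[cite: KozmaNitzan2024, §4 pp. 25–26 (the vertex over a cell centre); Lemma 12 (p. 24)] [cite: MartineauTassion2017, §4.3]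
-/

noncomputable section

open scoped Classical

namespace Summit.CriticalPhenomena.PercolationContinuityZ3.Theorems.Transplant

open Literature.Probability.LatticeModels SimpleGraph
open Literature.Barriers.CriticalPhenomena (graphBall graphBall_mono)

namespace PlanarSkeletonNeg

namespace NegB

open SkelConc (Consts)
open Neg

section Col

variable (κ : Consts) {V : Type} [DecidableEq V] [Countable V] {G : SimpleGraph V} [G.LocallyFinite] (Φ : PlanarSkeletonNeg G) (t : V)
  (p : unitInterval) (D : Skelφ.StepI.DataN V) (g f : ℕ) {φ' : V → Site 2}

/-- **THE COLUMN VERTEX OF RECORD over the cell centre `cen y`** (for the fine map `fine … φ′`, `φ′` 1-Lipschitz with unit steps, under the numeric long clause). [this work] -/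
def colV (hlip : Skelφ.Lip G φ') (hstep : Skelφ.Steps G φ') (hN : EqNumL κ Φ t p D g f) (y : Site 2) : V :=
  Classical.choose (hcol_fine_at κ Φ t p D g f hlip hstep hN y le_rfl)

/-- The defining property of `colV y`. [folklore] -/
theorem colV_spec (hlip : Skelφ.Lip G φ') (hstep : Skelφ.Steps G φ') (hN : EqNumL κ Φ t p D g f) (y : Site 2) :
    colV κ Φ t p D g f hlip hstep hN y ∈ Skelφ.VWin G (fine κ Φ t p D g f φ') t ((fcells κ Φ t p D g f).Q y) (Nrep κ Φ t p D g f ((fcells κ Φ t p D g f).cen y) + 1) ∧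
      fine κ Φ t p D g f φ' (colV κ Φ t p D g f hlip hstep hN y) = (fcells κ Φ t p D g f).cen y := by
  obtain ⟨h1, h2⟩ := Classical.choose_spec (hcol_fine_at κ Φ t p D g f hlip hstep hN y le_rfl)
  exact ⟨h1, h2⟩

/-- **`hcF`**: `F (colV y) = cen y`. [this work] -/
theorem colV_eq (hlip : Skelφ.Lip G φ') (hstep : Skelφ.Steps G φ') (hN : EqNumL κ Φ t p D g f) (y : Site 2) :
    fine κ Φ t p D g f φ' (colV κ Φ t p D g f hlip hstep hN y) = (fcells κ Φ t p D g f).cen y :=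
  (colV_spec κ Φ t p D g f hlip hstep hN y).2

/-- **`hcQ` at any radius** `R ≥ Nrep (cen y) + 1`: `colV y ∈ VWin F t (Q y) R`. [this work] -/
theorem colV_mem_VWin (hlip : Skelφ.Lip G φ') (hstep : Skelφ.Steps G φ') (hN : EqNumL κ Φ t p D g f) (y : Site 2) {R : ℕ}
    (hR : Nrep κ Φ t p D g f ((fcells κ Φ t p D g f).cen y) + 1 ≤ R) :
    colV κ Φ t p D g f hlip hstep hN y ∈ Skelφ.VWin G (fine κ Φ t p D g f φ') t ((fcells κ Φ t p D g f).Q y) R :=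
  Skelφ.VWin_mono subset_rfl hR (colV_spec κ Φ t p D g f hlip hstep hN y).1

/-- **`hcQ` at the schedule of record**: `colV y ∈ VWin F t (Q y) ((schedOf S).rQ a y)` for every level `a` and every input block `S`. [this work] -/
theorem colV_mem_VWin_schedOf (hlip : Skelφ.Lip G φ') (hstep : Skelφ.Steps G φ') (hN : EqNumL κ Φ t p D g f) (S : Skelφ.Prm.SchedIn) (a : ℕ) (y : Site 2) :
    colV κ Φ t p D g f hlip hstep hN y ∈ Skelφ.VWin G (fine κ Φ t p D g f φ') t ((fcells κ Φ t p D g f).Q y) ((schedOf κ Φ t p D g f S).rQ a y) :=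
  colV_mem_VWin κ Φ t p D g f hlip hstep hN y (colQ_schedOf κ Φ t p D g f S a y)

/-- **`hcD`**: `colV y ∈ graphBall t (cOff·(|y₀| + |y₁|) + 1)` (under `|h_L| ≤ 10·n_L`). [this work] -/
theorem colV_mem_graphBall (hlip : Skelφ.Lip G φ') (hstep : Skelφ.Steps G φ') (hN : EqNumL κ Φ t p D g f) (hκ : (hL κ Φ t p D g f).natAbs ≤ 10 * nL κ Φ t p D g f)
    (y : Site 2) : colV κ Φ t p D g f hlip hstep hN y ∈ graphBall G t (cOff κ Φ t p D g f * ((y 0).natAbs + (y 1).natAbs) + 1) := by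
  have h1 := Skelφ.mem_graphBall_of_mem_VWin (colV_spec κ Φ t p D g f hlip hstep hN y).1
  have h2 : Nrep κ Φ t p D g f ((fcells κ Φ t p D g f).cen y) + 1 ≤ cOff κ Φ t p D g f * ((y 0).natAbs + (y 1).natAbs) + 1 := offN_le κ Φ t p D g f hN hκ y
  exact graphBall_mono G t h2 h1

end Col

end NegB

end PlanarSkeletonNeg

end Summit.CriticalPhenomena.PercolationContinuityZ3.Theorems.Transplant

end
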